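import Summits.NavierStokesRegularity.NavierStokesRegularity.Theorems.RellichScarTypeIBlowupProfileZoomLimit
import HarnessLib

/-!
# T28-C storey (B2), zoom lemmas I: ONE subsequence of the zooms converging a.e. on the whole lower slab, and
# the a.e. `liminf` rate of the zoom limit for a TIME-DEPENDENT local rate
# (item `TerminalTrace.TypeITraceScarL3`, stmt-NavierStokesRegularity-18385, Stub LOUD line; helpers)

Seat nsreg-C26-p1 g2 (cell ns-regularity-ideate), `--supports stmt-NavierStokesRegularity-18385` (helper);
ROUND-28 §3 T28-C (nsreg-p2 g29), DIRECTOR-NS #130 (2).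

* `exists_subseq_ae_tendsto_of_L3loc` — if `F_j → w` in `L³(Q(a))` for every `a > 0` (each `F_j` eventually
  a.e.-strongly measurable on `Q(a)`), there is ONE index sequence `φ k ≥ k` with `F_{φ k} → w` a.e. on the whole
  slab `ℝ₋ × ℝ³` (fast subsequence: `‖F_{φ k} − w‖_{L³(Q(k+1))} ≤ 2^{−k}`, then `∑_k ∫ ‖·‖³ < ∞` on each
  `Q(n+1)` — no diagonal argument).
* `ae_liminfRate_of_zoomLimit_of_ball` — the time-dependent twin of `ae_rate_of_zoomLimit(_of_ball)`: if
  `‖v(s, y)‖ ≤ b(s)` for `−δ₁ < s < 0`, `|y| < ρ₁` (ANY function `b`), the zooms `λ_j v(λ_j² s, λ_j y)`,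
  `λ_j → 0⁺`, converge in `L³(Q(a))` to `w` for every `a`, then along a subsequence `φ` (`φ k ≥ k`) the limit
  obeys `‖w(s, y)‖ₑ ≤ liminf_k λ_{φ k} b(λ_{φ k}² s)` for a.e. `(s, y)` in the slab.  (A `liminf` along ONE
  a.e.-convergent subsequence — this is what Fatou needs downstream; a bound by the `liminf` over all `j` is
  not available.)

WHAT THIS IS NOT: not the (LM_q) transfer itself (Fatou + parabolic change of variables, next file), not NS
regularity.  [folklore; AlbrittonBarker2019 §3; Seregin2014 §6.6]
-/

noncomputable section

set_option linter.dupNamespace false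

namespace Summit.NavierStokesRegularity.NavierStokesRegularity.Theorems.TypeITraceScarL3

open MeasureTheory Set Function Filter Topology TopologicalSpace Metric
open Literature.Analysis Literature.Analysis.FluidPDE
open scoped NNReal ENNReal

/-- **One subsequence converging a.e. on the whole lower slab** from `L³(Q(a))`-convergence for every `a`
(module docstring). [folklore] -/
theorem exists_subseq_ae_tendsto_of_L3loc
    {F : ℕ → ℝ × EuclideanSpace ℝ (Fin 3) → EuclideanSpace ℝ (Fin 3)}
    {w : ℝ × EuclideanSpace ℝ (Fin 3) → EuclideanSpace ℝ (Fin 3)}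
    (hFm : ∀ a : ℝ, 0 < a → ∀ᶠ j in atTop,
      AEStronglyMeasurable (F j) (volume.restrict (parabolicCylinder a (0 : ℝ × EuclideanSpace ℝ (Fin 3)))))
    (hwm : ∀ a : ℝ, 0 < a →
      AEStronglyMeasurable w (volume.restrict (parabolicCylinder a (0 : ℝ × EuclideanSpace ℝ (Fin 3)))))
    (hconv : ∀ a : ℝ, 0 < a → Tendsto (fun j => eLpNorm (F j - w) 3
      (volume.restrict (parabolicCylinder a (0 : ℝ × EuclideanSpace ℝ (Fin 3))))) atTop (𝓝 0)) :
    ∃ φ : ℕ → ℕ, (∀ k, k ≤ φ k) ∧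
      ∀ᵐ z ∂(volume.restrict (Iio (0 : ℝ) ×ˢ (univ : Set (EuclideanSpace ℝ (Fin 3))))),
        Tendsto (fun k => F (φ k) z) atTop (𝓝 (w z)) := by
  -- ### the fast subsequence
  have hchoice : ∀ k : ℕ, ∃ j : ℕ, k ≤ j ∧
      AEStronglyMeasurable (F j)
        (volume.restrict (parabolicCylinder ((k : ℝ) + 1) (0 : ℝ × EuclideanSpace ℝ (Fin 3)))) ∧
      eLpNorm (F j - w) 3
        (volume.restrict (parabolicCylinder ((k : ℝ) + 1) (0 : ℝ × EuclideanSpace ℝ (Fin 3)))) ≤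
        (2⁻¹ : ℝ≥0∞) ^ k := by
    intro k
    have ha : (0 : ℝ) < (k : ℝ) + 1 := by positivity
    have hpos : (0 : ℝ≥0∞) < (2⁻¹ : ℝ≥0∞) ^ k := ENNReal.pow_pos (by norm_num) _
    exact ((eventually_ge_atTop k).and ((hFm _ ha).and
      ((hconv _ ha).eventually_le_const hpos))).exists
  choose φ hφ using hchoice
  refine ⟨φ, fun k => (hφ k).1, ?_⟩
  -- ### reduce to the exhausting cylinders `Q(n + 1)`
  have hcover : Iio (0 : ℝ) ×ˢ (univ : Set (EuclideanSpace ℝ (Fin 3))) ⊆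
      ⋃ n : ℕ, parabolicCylinder ((n : ℝ) + 1) (0 : ℝ × EuclideanSpace ℝ (Fin 3)) := by
    rintro ⟨s, y⟩ ⟨hs, -⟩
    obtain ⟨n, hn⟩ := exists_nat_ge (max (-s) ‖y‖)
    have h1 : -s ≤ n := (le_max_left _ _).trans hn
    have h2 : ‖y‖ ≤ n := (le_max_right _ _).trans hn
    have hs' : s < 0 := hs
    refine mem_iUnion.2 ⟨n, ?_⟩
    rw [SuitableCompactness.mem_parabolicCylinder_zero]
    refine ⟨⟨?_, hs'⟩, by simp only; linarith⟩
    have h3 : (n : ℝ) + 1 ≤ ((n : ℝ) + 1) ^ 2 := by nlinarith [n.cast_nonneg (α := ℝ)]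
    simp only
    linarith
  refine ae_restrict_of_ae_restrict_of_subset hcover ?_
  rw [ae_restrict_iUnion_iff]
  intro n
  set Q₀ : Set (ℝ × EuclideanSpace ℝ (Fin 3)) :=
    parabolicCylinder ((n : ℝ) + 1) (0 : ℝ × EuclideanSpace ℝ (Fin 3)) with hQ₀
  have hn0 : (0 : ℝ) < (n : ℝ) + 1 := by positivity
  -- the shifted differences `g k = F (φ (k + n)) − w` have `‖g k‖_{L³(Q₀)} ≤ 2^{-(k+n)} ≤ 2^{-k}`
  have hsubQ : ∀ k : ℕ, Q₀ ⊆ parabolicCylinder (((k + n : ℕ) : ℝ) + 1) (0 : ℝ × EuclideanSpace ℝ (Fin 3)) :=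
    fun k => SuitableCompactness.parabolicCylinder_zero_mono hn0.le (by push_cast; linarith)
  have hgm : ∀ k : ℕ, AEStronglyMeasurable (F (φ (k + n)) - w) (volume.restrict Q₀) := fun k =>
    ((hφ (k + n)).2.1.mono_measure (Measure.restrict_mono (hsubQ k) le_rfl)).sub (hwm _ hn0)
  have hgle : ∀ k : ℕ, eLpNorm (F (φ (k + n)) - w) 3 (volume.restrict Q₀) ≤ (2⁻¹ : ℝ≥0∞) ^ k := by
    intro k
    refine ((eLpNorm_mono_measure _ (Measure.restrict_mono (hsubQ k) le_rfl)).trans (hφ (k + n)).2.2).trans ?_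
    exact pow_le_pow_right_of_le_one' (by norm_num) (Nat.le_add_right k n)
  -- `∫ ‖g k‖³ ≤ 2^{-k}`
  have hcube : ∀ k : ℕ, ∫⁻ z, ‖(F (φ (k + n)) - w) z‖ₑ ^ (3 : ℝ) ∂(volume.restrict Q₀) ≤
      (2⁻¹ : ℝ≥0∞) ^ k := by
    intro k
    have h3 : eLpNorm (F (φ (k + n)) - w) 3 (volume.restrict Q₀) =
        (∫⁻ z, ‖(F (φ (k + n)) - w) z‖ₑ ^ (3 : ℝ) ∂(volume.restrict Q₀)) ^ (1 / (3 : ℝ)) := by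
      rw [eLpNorm_eq_lintegral_rpow_enorm_toReal (by norm_num) (by norm_num)]
      norm_num
    have h1 : (∫⁻ z, ‖(F (φ (k + n)) - w) z‖ₑ ^ (3 : ℝ) ∂(volume.restrict Q₀)) =
        (eLpNorm (F (φ (k + n)) - w) 3 (volume.restrict Q₀)) ^ (3 : ℝ) := by
      rw [h3, ← ENNReal.rpow_mul]; norm_num
    rw [h1]
    have hle1 : eLpNorm (F (φ (k + n)) - w) 3 (volume.restrict Q₀) ≤ 1 :=
      (hgle k).trans (pow_le_one₀ (by norm_num) (by norm_num))
    exact (ENNReal.rpow_le_self_of_le_one hle1 (by norm_num)).trans (hgle k)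
  -- `∑_k ∫ ‖g k‖³ < ∞`, hence `∑_k ‖g k(z)‖³ < ∞` a.e., hence `‖g k(z)‖ → 0` a.e.
  have hmeas : ∀ k : ℕ, AEMeasurable (fun z => ‖(F (φ (k + n)) - w) z‖ₑ ^ (3 : ℝ)) (volume.restrict Q₀) :=
    fun k => (hgm k).enorm.pow_const _
  have htsum : ∫⁻ z, ∑' k, ‖(F (φ (k + n)) - w) z‖ₑ ^ (3 : ℝ) ∂(volume.restrict Q₀) ≠ ⊤ := by
    rw [lintegral_tsum hmeas]
    refine ne_top_of_le_ne_top ?_ (ENNReal.tsum_le_tsum hcube)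
    rw [ENNReal.tsum_geometric]
    norm_num
  have hae : ∀ᵐ z ∂(volume.restrict Q₀), ∑' k, ‖(F (φ (k + n)) - w) z‖ₑ ^ (3 : ℝ) < ⊤ :=
    ae_lt_top' (AEMeasurable.tsum hmeas) htsum
  filter_upwards [hae] with z hz
  have h0 : Tendsto (fun k => ‖(F (φ (k + n)) - w) z‖ₑ ^ (3 : ℝ)) atTop (𝓝 0) :=
    ENNReal.tendsto_atTop_zero_of_tsum_ne_top hz.ne
  have h1 : Tendsto (fun k => ‖(F (φ (k + n)) - w) z‖ₑ) atTop (𝓝 0) := by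
    have h2 := ((ENNReal.continuous_rpow_const (y := (1 / 3 : ℝ))).tendsto 0).comp h0
    rw [ENNReal.zero_rpow_of_pos (by norm_num)] at h2
    refine h2.congr fun k => ?_
    simp only [Function.comp_apply]
    rw [← ENNReal.rpow_mul]; norm_num
  have h3 : Tendsto (fun k => F (φ (k + n)) z) atTop (𝓝 (w z)) := by
    rw [tendsto_iff_norm_sub_tendsto_zero]
    have h4 : Tendsto (fun k => ‖(F (φ (k + n)) - w) z‖) atTop (𝓝 0) := by
      have h5 := (ENNReal.tendsto_toReal ENNReal.zero_ne_top).comp h1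
      rw [ENNReal.toReal_zero] at h5
      refine h5.congr fun k => ?_
      simp only [Function.comp_apply, enorm_eq_nnnorm, ENNReal.coe_toReal, coe_nnnorm]
    simpa only [Pi.sub_apply] using h4
  exact (tendsto_add_atTop_iff_nat n).1 h3

end Summit.NavierStokesRegularity.NavierStokesRegularity.Theorems.TypeITraceScarL3

end
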